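import Literature.MathematicalPhysics.QuantumFieldTheory.Balaban1983to89.B12BetaHolo
import Literature.MathematicalPhysics.QuantumFieldTheory.Balaban1983to89.B12Eq213AnalyticHistory
import Literature.MathematicalPhysics.QuantumFieldTheory.Balaban1983to89.T4CouplingLogLayer

/-!
# BalabanUVNodes ∕ N22 = NE9, THE QUANTITATIVE ROUTE IN THE LAST COUPLING — analyticity of the localized term
# `E^{(k+1)}(X, g_k, φ)` on the TYPED complex disc in `g_k` ([Balaban1987RG1] p. 263 «(or analytic)», p. 266; typed as
# `B12BetaHolo.EHoloAt`, node N09's per-step delivery currency) ⟹ by ONE Cauchy estimate: the age-0 sup letter (A), the age-0 strip ∕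
# derivative letter (A′), the Lipschitz letter `‖ΔE‖ ≤ (E₀∕r)·e^{−κd_{k+1}(X)}·|Δg_k|` and every `C^{n,1}` letter, all WITH the printed decay
# factor and constants explicit in `(E₀, r)`; and the reading of such a last-coupling letter against node N22's statement of record
# (Track A, DAG node N22; cluster K3 `SpineGivenEndpointR11`; seat `pub-ymgap-dag-n22-d`, R134 strategy s3 «alternative currency»)

HONEST FRAMING.  Count-neutral kernel bookkeeping; NOT a node discharge; NE9 ∕ `FadingMemory` NOT IN PRINT, NOT PROVED for Bałaban's
functionals; one finite four-torus programme at fixed ε; nothing continuum ∕ ℝ⁴ ∕ OS ∕ mass-gap ∕ Clay.  0 `sorry`, 0 `def`, standard axioms.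
§1 is one-variable complex analysis ([folklore]); §§2–3 are theorems about the HYPOTHESIS SCHEMA `B12BetaHolo.EHoloAt T c k` over the small-field
tower `Step.SFTower` (data + hypotheses, never asserted); §4 is bookkeeping over the abstract carriers of `T4OutputRate`.  `--supports` item
`SpineGivenEndpointR11` (route «BalabanUVNodes», rev 6).

WHY THIS CURRENCY (the s3 row: «quantitative route: analyticity in the last coupling ([I] p. 263, [II]) ⇒ Lipschitz via a Cauchy estimate on
the typed disc»).  Node N22's abstract-carrier knits (`BalabanUVNodesN22Knit*`, seat n22-a) consume, in EACH young coupling, a regularity letter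
carrying the printed decay factor `e^{−κd(X)}`: ROAD 3's (A) = `‖F‖ ≤ M·μ^{age}·e^{−κd}` on closed `r`-discs (`…N22KnitTwoConstants`), (A′) =
`‖F′‖ ≤ L·μ^{age}·e^{−κd}` on open discs (`…N22KnitStrip`), ROAD 2's (R) = `C^{1,1}` with constant `M·e^{−κd}` (`…N22Knit`).  The twin seat
n22-b's body-level chain (`B12Eq213AnalyticCoupling`, `B12Eq213AnalyticHistory` §§1–5) delivers the analytic letters on the UN-LOCALISED (2.13)
body, where no decay factor exists and — the exponent of (2.13) being a volume sum of `B12ZeroCoupling268` shares `φ_X(z)`, each analytic on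
`|z|‖X‖ < r` with `‖φ_X(z)‖ ≤ C₃|z|‖X‖³` — the imaginary-part letter `m₁ < π∕2` of `B12Eq213AnalyticHistory.birth_letters` can only hold on a
strip of width `∼ 1∕volume`: the Cauchy estimate is volume-uniform only AFTER localization.  The tree types the localized analytic clause of
p. 263 ∕ p. 266 in exactly one place: `B12BetaHolo.EHoloAt T c k` — for every domain `X` and configuration `φ ∈ Uᶜ_{k+1}(X, α₀, α₁)` the new
term `g ↦ E^{(k+1)}(X, g, φ)` is on `[0, γ]` the trace of `Ec X φ`, HOLOMORPHIC on an open `U ⊇` the closed `r`-discs about `[0, γ]`, with (1.18)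
ON `U`: `‖Ec X φ z‖ ≤ E₀·e^{−κ d_{k+1}(X)}` — and this is the per-step source by which node N09's knit closes [I]'s Theorem 3
(`B12NodeKnit.b12_main_of_up_frameOf_of_b13Family_eHolo`, hypothesis `hE : ∀ k < K, EHoloAt T c k`).  THIS FILE reads that source for N22:
* §1 `derivLetter_of_supLetter_closedBalls` — Cauchy: `F` holomorphic on `U ⊇ D̄(t, r)` (`t` in a real index set `S`) with `‖F‖ ≤ M` on `U` ⟹ on
  `D = ⋃_{t ∈ S} D(t, r∕2)`: `‖F′‖ ≤ 2M∕r` (`B12Eq213AnalyticHistory.letters_of_norm_le` BY NAME); `norm_sub_le_of_supLetter_closedBall` — the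
  two-point form `‖F z − F w‖ ≤ (2M∕r)‖z − w‖` on each `D(t, r∕2)`; `norm_deriv_le_of_supLetter_closedBall` — `‖F′(t)‖ ≤ M∕r` at the centres.
  §1b `rect_isOpen` ∕ `rect_convex` ∕ `ofReal_re_mem_rect` ∕ `ofReal_mem_rect` ∕ `rect_subset_iUnion_ball` — the open rectangle of half-width `ρ` about
  `[0, γ]` is ONE convex `Re`-closed neighbourhood of the window inside the `2ρ`-discs (the shape `(hO, hOc, hOre)` of `analyticHistory_letters`).
* §2 ON `EHoloAt T c k`, per `(X, φ)`: **`supLetter_lastCoupling_of_eHolo`** (ROAD 3's (A) at age 0: `M = E₀`, radius `r`, the typed disc itself);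
  **`stripLetter_lastCoupling_of_eHolo`** ((A′) at age 0: `L = 2E₀∕r`, radius `r∕2` — the clause shape `hA` of
  `N22KnitStrip.ne9_and_fadingMemory_of_osc_strip` at `i = scale X − 1`, on the CLOSED interval); `norm_sub_lastCoupling_complex_le_of_eHolo` (two-point
  form on the complex `r∕2`-discs); `norm_deriv_lastCoupling_le_of_eHolo` (`‖Ec′(t)‖ ≤ (E₀∕r)e^{−κd}` at real `t`);
  **`birthLetter_lastCoupling_of_eHolo`** (the four-part BIRTH letter of `B12Eq213AnalyticHistory.analyticHistory_letters` for the LOCALIZED term on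
  the rectangle of half-width `r∕4`: holomorphy, `|Im| ≤ E₀e^{−κd}`, `‖∂_z‖ ≤ (2E₀∕r)e^{−κd}`, real compatibility — one `O` for all `(X, φ)`);
  **`norm_iteratedDerivWithin_sub_le_of_eHolo`** (every `C^{n,1}` letter: `‖∂ⁿE(g) − ∂ⁿE(g′)‖ ≤ (n+1)!·E₀·r^{−(n+1)}·e^{−κd}·|g − g′|` on `[0, γ]`,
  from `EHoloAt.eDerivBoundAt` + the mean value inequality) with its two named instances **`norm_sub_lastCoupling_le_of_eHolo`** (`n = 0`: THE
  LIPSCHITZ LETTER `(E₀∕r)·e^{−κd}`) and `norm_derivWithin_sub_le_of_eHolo` (`n = 1`: ROAD 2's (R) at age 0, constant `2E₀∕r²·e^{−κd}`).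
* §3 `norm_sub_lastCoupling_le_uniform_of_eHolo` — along N09's family `∀ k < K, EHoloAt T c k` with `(S k).E₀ ≤ E₀`, `r ≤ (S k).r`: ONE k-uniform
  last-coupling modulus `E₀∕r` for every term `E^{(k+1)}`, `k < K` (k-uniformity of the Lipschitz letter ⇔ k-uniformity of the typed disc's two numbers).
* §4 READING AGAINST N22's STATEMENT (abstract carriers `T4OutputRate.Carriers`): `sum_lastOnly_const` · **`ne9_of_lastCouplingLetter`** — a functional
  whose `g`-differences are controlled by the LAST coupling alone with modulus `L·e^{−κd}` satisfies `NE9 E W κ (lastOnly (fun _ _ ↦ L))`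
  (`T4CouplingLogLayer.lastOnly`); `ne9_and_fadingMemory_of_lastCouplingLetter` — together with `T4CouplingLogLayer.fadingMemory_lastOnly_const`
  BY NAME: `NE9 ∧ FadingMemory (L∕ω) ω` for every `ω ∈ ]0, 1]`.  HONEST: the small-field tower types `E^{(j)}(X, g_{j−1}, φ)` as a function of the
  LAST coupling only (MARKOV typing, `Step.SFTower.E`), so for terms so typed node N22's memory clause is IDLE (memory length one) and the whole
  content of `NE9 ∧ FadingMemory` is §2's Lipschitz letter; the HISTORY content of N22 (print p. 256, p. 298: `𝐄_k` depends on `g_0, …, g_{k−1}`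
  through the curly bracket of (2.12)) is the object W1 = [Balaban1988RG2Cluster] §2 (2.13)–(2.14) (s1's row, definer seat `node00-def-W1`),
  untouched here.  Nothing in this file weakens the vertex verdict of `BalabanUVNodesN22KnitVertexWitness` (it concerns OLDER couplings).

References (TYPES only): [Balaban1987RG1] = T. Bałaban, Commun. Math. Phys. **109** (1987) 249–301 — p. 256, (1.18) and the C^∞ ∕ analytic
clause p. 263, p. 266 (after (2.9)), (2.12)–(2.13) p. 268, p. 298; [Balaban1988RG2Cluster] = T. Bałaban, Commun. Math. Phys. **116** (1988)
1–22 — §2 (2.13)–(2.14), (2.40)–(2.41).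
-/

noncomputable section

namespace Summit.QuantumFields.YangMills.BalabanUVNodes.N22LastCouplingHolo

open Set Metric Complex
open Literature.MathematicalPhysics.QuantumFieldTheory.Balaban1983to89
open Literature.MathematicalPhysics.QuantumFieldTheory.Balaban1983to89.B12Eq213AnalyticHistory (letters_of_norm_le)

/-! ## §1 Cauchy: a sup letter on the closed `r`-discs about a real set is a derivative letter on the open `r∕2`-discs -/

section Cauchy

variable {F : ℂ → ℂ} {U : Set ℂ} {r M : ℝ}

/-- **CAUCHY ON THE TYPED DISC.**  `F` holomorphic on an open-or-not set `U` containing the closed `r`-discs about the real points of `S`,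
`‖F‖ ≤ M` on `U` (`0 < r`): on `D = ⋃_{t ∈ S} D(t, r∕2)` the function is holomorphic with **`‖F′‖ ≤ 2M∕r`**, `D ⊇ D(t, r∕2)` for `t ∈ S`, and
`D ⊆ U` (Cauchy's estimate on the circle of radius `r∕2`, `B12Eq213AnalyticHistory.letters_of_norm_le`). [folklore] -/
theorem derivLetter_of_supLetter_closedBalls {S : Set ℝ} (hr : 0 < r) (hF : DifferentiableOn ℂ F U) (hM : ∀ z ∈ U, ‖F z‖ ≤ M)
    (hU : ∀ t ∈ S, closedBall (t : ℂ) r ⊆ U) :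
    DifferentiableOn ℂ F (⋃ t ∈ S, ball (t : ℂ) (r / 2)) ∧
    (∀ z ∈ ⋃ t ∈ S, ball (t : ℂ) (r / 2), ‖deriv F z‖ ≤ 2 * M / r) ∧
    (∀ t ∈ S, ball (t : ℂ) (r / 2) ⊆ ⋃ t ∈ S, ball (t : ℂ) (r / 2)) ∧
    (⋃ t ∈ S, ball (t : ℂ) (r / 2)) ⊆ U := by
  have hsub : (⋃ t ∈ S, ball (t : ℂ) (r / 2)) ⊆ U := by
    intro z hz
    obtain ⟨t, ht, hzt⟩ := mem_iUnion₂.1 hz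
    exact hU t ht (ball_subset_closedBall (ball_subset_ball (by linarith) hzt))
  refine ⟨hF.mono hsub, ?_, fun t ht => subset_iUnion₂ (s := fun (t : ℝ) (_ : t ∈ S) => ball (t : ℂ) (r / 2)) t ht, hsub⟩
  intro z hz
  obtain ⟨t, ht, hzt⟩ := mem_iUnion₂.1 hz
  have hball : ball (t : ℂ) r ⊆ U := ball_subset_closedBall.trans (hU t ht)
  have h := (letters_of_norm_le (c := (t : ℂ)) (by linarith : r / 2 < r) (hF.mono hball) (fun w hw => hM w (hball hw))).2 z hzt
  have e : M / (r - r / 2) = 2 * M / r := by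
    field_simp
    ring
  rw [← e]
  exact h

/-- **TWO-POINT FORM ON ONE DISC**: under the same letters, `‖F z − F w‖ ≤ (2M∕r)·‖z − w‖` for `z, w ∈ D(t, r∕2)`, `D̄(t, r) ⊆ U` (mean value on the
convex disc). [folklore] -/
theorem norm_sub_le_of_supLetter_closedBall {t : ℝ} (hr : 0 < r) (hF : DifferentiableOn ℂ F U) (hM : ∀ z ∈ U, ‖F z‖ ≤ M)
    (hU : closedBall (t : ℂ) r ⊆ U) {z w : ℂ} (hz : z ∈ ball (t : ℂ) (r / 2)) (hw : w ∈ ball (t : ℂ) (r / 2)) :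
    ‖F z - F w‖ ≤ 2 * M / r * ‖z - w‖ := by
  obtain ⟨hD, hderiv, hballs, -⟩ :=
    derivLetter_of_supLetter_closedBalls (S := {t}) hr hF hM (fun s hs => by rw [mem_singleton_iff.1 hs]; exact hU)
  have hsub : ball (t : ℂ) (r / 2) ⊆ ⋃ s ∈ ({t} : Set ℝ), ball (s : ℂ) (r / 2) := hballs t (mem_singleton t)
  have hdiff : ∀ x ∈ ball (t : ℂ) (r / 2), DifferentiableAt ℂ F x := fun x hx =>
    (hD.mono hsub).differentiableAt (isOpen_ball.mem_nhds hx)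
  exact (convex_ball (t : ℂ) (r / 2)).norm_image_sub_le_of_norm_deriv_le hdiff (fun x hx => hderiv x (hsub hx)) hw hz

/-- **CAUCHY AT A REAL CENTRE**: `D̄(t, r) ⊆ U`, `‖F‖ ≤ M` on `U` ⟹ `‖F′(t)‖ ≤ M∕r` (the full radius is available at the centre). [folklore] -/
theorem norm_deriv_le_of_supLetter_closedBall {t : ℝ} (hr : 0 < r) (hF : DifferentiableOn ℂ F U) (hM : ∀ z ∈ U, ‖F z‖ ≤ M)
    (hU : closedBall (t : ℂ) r ⊆ U) : ‖deriv F t‖ ≤ M / r := by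
  have hdc : DiffContOnCl ℂ F (ball (t : ℂ) r) := hF.diffContOnCl_ball hU
  exact Complex.norm_deriv_le_of_forall_mem_sphere_norm_le hr hdc fun w hw => hM w (hU (sphere_subset_closedBall hw))

end Cauchy

/-! ## §1b The open rectangle of half-width `ρ` about `[0, γ]`: one convex, `Re`-closed neighbourhood inside the `2ρ`-discs -/

section Rect

variable {γ ρ : ℝ}

/-- The rectangle `{−ρ < Re z < γ + ρ, |Im z| < ρ}` is open. [folklore] -/
theorem rect_isOpen (γ ρ : ℝ) : IsOpen {z : ℂ | z.re ∈ Ioo (-ρ) (γ + ρ) ∧ z.im ∈ Ioo (-ρ) ρ} :=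
  (isOpen_Ioo.preimage Complex.continuous_re).inter (isOpen_Ioo.preimage Complex.continuous_im)

/-- The rectangle is convex (intersection of two slabs, preimages of intervals under the `ℝ`-linear maps `Re`, `Im`). [folklore] -/
theorem rect_convex (γ ρ : ℝ) : Convex ℝ {z : ℂ | z.re ∈ Ioo (-ρ) (γ + ρ) ∧ z.im ∈ Ioo (-ρ) ρ} :=
  ((convex_Ioo (-ρ) (γ + ρ)).linear_preimage Complex.reLm).inter ((convex_Ioo (-ρ) ρ).linear_preimage Complex.imLm)

/-- The rectangle is closed under `z ↦ Re z`. [folklore] -/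
theorem ofReal_re_mem_rect {z : ℂ} (hz : z ∈ {z : ℂ | z.re ∈ Ioo (-ρ) (γ + ρ) ∧ z.im ∈ Ioo (-ρ) ρ}) :
    ((z.re : ℝ) : ℂ) ∈ {z : ℂ | z.re ∈ Ioo (-ρ) (γ + ρ) ∧ z.im ∈ Ioo (-ρ) ρ} := by
  obtain ⟨hre, him⟩ := hz
  have hρ : 0 < ρ := by
    have h1 := him.1
    have h2 := him.2
    linarith
  refine ⟨by simpa using hre, ?_⟩
  simp only [Complex.ofReal_im, mem_Ioo]
  exact ⟨by linarith, hρ⟩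

/-- The rectangle contains the window `[0, γ]` (`ρ > 0`). [folklore] -/
theorem ofReal_mem_rect (hρ : 0 < ρ) {t : ℝ} (ht : t ∈ Icc (0 : ℝ) γ) :
    (t : ℂ) ∈ {z : ℂ | z.re ∈ Ioo (-ρ) (γ + ρ) ∧ z.im ∈ Ioo (-ρ) ρ} := by
  simp only [mem_setOf_eq, Complex.ofReal_re, Complex.ofReal_im, mem_Ioo]
  exact ⟨⟨by linarith [ht.1], by linarith [ht.2]⟩, by linarith, hρ⟩

/-- Every point of the rectangle is within `2ρ` of a point of `[0, γ]` (`γ ≥ 0`): clamp the real part to the window. [folklore] -/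
theorem rect_subset_iUnion_ball (hγ : 0 ≤ γ) :
    {z : ℂ | z.re ∈ Ioo (-ρ) (γ + ρ) ∧ z.im ∈ Ioo (-ρ) ρ} ⊆ ⋃ t ∈ Icc (0 : ℝ) γ, ball (t : ℂ) (2 * ρ) := by
  rintro z ⟨⟨hre1, hre2⟩, ⟨him1, him2⟩⟩
  set s : ℝ := max 0 (min z.re γ) with hs
  have hsI : s ∈ Icc (0 : ℝ) γ := ⟨le_max_left _ _, max_le hγ (min_le_right _ _)⟩
  have hds : |z.re - s| < ρ := by
    rw [abs_lt]
    rcases le_or_gt 0 z.re with h0 | h0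
    · rcases le_or_gt z.re γ with h1 | h1
      · have : s = z.re := by rw [hs, min_eq_left h1, max_eq_right h0]
        rw [this]; constructor <;> linarith
      · have : s = γ := by rw [hs, min_eq_right h1.le, max_eq_right hγ]
        rw [this]; constructor <;> linarith
    · have : s = 0 := by
        rw [hs, max_eq_left]
        exact (min_le_left _ _).trans h0.le
      rw [this]; constructor <;> linarith
  refine mem_iUnion₂.2 ⟨s, hsI, ?_⟩
  rw [mem_ball, dist_eq_norm]
  have him : |z.im| < ρ := abs_lt.2 ⟨him1, him2⟩
  calc ‖z - (s : ℂ)‖ ≤ |(z - (s : ℂ)).re| + |(z - (s : ℂ)).im| := Complex.norm_le_abs_re_add_abs_im _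
    _ = |z.re - s| + |z.im| := by simp
    _ < ρ + ρ := add_lt_add hds him
    _ = 2 * ρ := by ring

end Rect

/-! ## §2 On the typed disc `B12BetaHolo.EHoloAt T c k`: the age-0 letters of node N22 for the term `E^{(k+1)}(X, ·, φ)` -/

section Tower

open Literature.MathematicalPhysics.QuantumFieldTheory.Balaban1983to89.Step
open Literature.MathematicalPhysics.QuantumFieldTheory.Balaban1983to89.B12BetaHolo

variable {P : Params} {G : Type*} [GaugeGroup G] {Φ 𝒢 : Type*} {T : SFTower P G Φ 𝒢} {c : SFConsts} {k : ℕ}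

/-- **ROAD 3's LETTER (A) AT AGE 0 IS THE TYPED DISC ITSELF.**  From `S : EHoloAt T c k`, for `φ ∈ Uᶜ_{k+1}(X, α₀, α₁)`: the section
`g ↦ E^{(k+1)}(X, g, φ)` on `[0, γ]` extends to `F = S.Ec X φ`, holomorphic on `D = S.U ⊇ D̄(t, r)` (`t ∈ [0, γ]`) with the UNCENTRED sup letter
`‖F‖ ≤ E₀·e^{−κ d_{k+1}(X)}` — the `i = scale − 1` clause of `N22KnitTwoConstants.ne9_and_fadingMemory_of_osc_analytic_rpow`'s letter (A), per section.
[cite: Balaban1987RG1, p.263 (clause before (1.18)) with p.266 (after (2.9))] -/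
theorem supLetter_lastCoupling_of_eHolo (S : EHoloAt T c k) (X : (T.sys (k + 1)).Dom) {φ : Φ}
    (hφ : φ ∈ T.space (k + 1) X c.α₀ c.α₁) :
    ∃ (F : ℂ → ℂ) (D : Set ℂ), DifferentiableOn ℂ F D ∧
      (∀ z ∈ D, ‖F z‖ ≤ S.E₀ * Real.exp (-c.κ * (T.sys (k + 1)).dj X)) ∧
      (∀ t ∈ Icc (0 : ℝ) c.γ, closedBall (t : ℂ) S.r ⊆ D) ∧ (∀ t ∈ Icc (0 : ℝ) c.γ, F t = T.E (k + 1) X t φ) :=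
  ⟨S.Ec X φ, S.U, S.holo X φ hφ, S.bound X φ hφ, S.ball_subset, fun t ht => (S.eq X φ hφ t ht).symm⟩

/-- **ROAD 3's STRIP LETTER (A′) AT AGE 0, BY CAUCHY.**  From `S : EHoloAt T c k`, for `φ ∈ Uᶜ_{k+1}(X, α₀, α₁)`: the section
`g ↦ E^{(k+1)}(X, g, φ)` on `[0, γ]` extends to `F` holomorphic on a set `D ⊇ D(t, r∕2)` (`t ∈ [0, γ]`) with the DERIVATIVE letter
**`‖F′‖ ≤ (2E₀∕r)·e^{−κ d_{k+1}(X)}`** on `D` — the `i = scale − 1` clause of `N22KnitStrip.ne9_and_fadingMemory_of_osc_strip`'s letter (A′) (`L = 2E₀∕r`,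
radius `r∕2`, growth factor `μ^0`), per section, on the closed interval. [cite: Balaban1987RG1, p.263 (clause before (1.18)) with p.266 (after (2.9)) and (1.18)] -/
theorem stripLetter_lastCoupling_of_eHolo (S : EHoloAt T c k) (X : (T.sys (k + 1)).Dom) {φ : Φ}
    (hφ : φ ∈ T.space (k + 1) X c.α₀ c.α₁) :
    ∃ (F : ℂ → ℂ) (D : Set ℂ), DifferentiableOn ℂ F D ∧
      (∀ z ∈ D, ‖deriv F z‖ ≤ 2 * S.E₀ / S.r * Real.exp (-c.κ * (T.sys (k + 1)).dj X)) ∧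
      (∀ t ∈ Icc (0 : ℝ) c.γ, ball (t : ℂ) (S.r / 2) ⊆ D) ∧ (∀ t ∈ Icc (0 : ℝ) c.γ, F t = T.E (k + 1) X t φ) := by
  obtain ⟨hD, hderiv, hballs, -⟩ := derivLetter_of_supLetter_closedBalls (S := Icc (0 : ℝ) c.γ) S.r_pos (S.holo X φ hφ)
    (S.bound X φ hφ) S.ball_subset
  refine ⟨S.Ec X φ, ⋃ t ∈ Icc (0 : ℝ) c.γ, ball (t : ℂ) (S.r / 2), hD, fun z hz => ?_, hballs,
    fun t ht => (S.eq X φ hφ t ht).symm⟩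
  have e : 2 * (S.E₀ * Real.exp (-c.κ * (T.sys (k + 1)).dj X)) / S.r
      = 2 * S.E₀ / S.r * Real.exp (-c.κ * (T.sys (k + 1)).dj X) := by ring
  rw [← e]
  exact hderiv z hz

/-- **THE TWO-POINT LETTER ON THE COMPLEX `r∕2`-DISCS** (the shape a complex consumer — the next step's birth letter — reads): for `t ∈ [0, γ]`
and `z, w ∈ D(t, r∕2)`, `‖Ec X φ z − Ec X φ w‖ ≤ (2E₀∕r)·e^{−κ d_{k+1}(X)}·‖z − w‖`. [cite: Balaban1987RG1, p.266 (after (2.9)) with (1.18) p.263] -/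
theorem norm_sub_lastCoupling_complex_le_of_eHolo (S : EHoloAt T c k) (X : (T.sys (k + 1)).Dom) {φ : Φ}
    (hφ : φ ∈ T.space (k + 1) X c.α₀ c.α₁) {t : ℝ} (ht : t ∈ Icc (0 : ℝ) c.γ) {z w : ℂ}
    (hz : z ∈ ball (t : ℂ) (S.r / 2)) (hw : w ∈ ball (t : ℂ) (S.r / 2)) :
    ‖S.Ec X φ z - S.Ec X φ w‖ ≤ 2 * S.E₀ / S.r * Real.exp (-c.κ * (T.sys (k + 1)).dj X) * ‖z - w‖ := by
  have h := norm_sub_le_of_supLetter_closedBall S.r_pos (S.holo X φ hφ) (S.bound X φ hφ) (S.ball_subset t ht) hz hw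
  have e : 2 * (S.E₀ * Real.exp (-c.κ * (T.sys (k + 1)).dj X)) / S.r
      = 2 * S.E₀ / S.r * Real.exp (-c.κ * (T.sys (k + 1)).dj X) := by ring
  rw [← e]
  exact h

/-- **THE COMPLEX DERIVATIVE AT REAL COUPLINGS**: `‖Ec′(t)‖ ≤ (E₀∕r)·e^{−κ d_{k+1}(X)}` for `t ∈ [0, γ]` (Cauchy on the full typed disc `D̄(t, r)`).
[cite: Balaban1987RG1, p.266 (after (2.9)) with (1.18) p.263] -/
theorem norm_deriv_lastCoupling_le_of_eHolo (S : EHoloAt T c k) (X : (T.sys (k + 1)).Dom) {φ : Φ}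
    (hφ : φ ∈ T.space (k + 1) X c.α₀ c.α₁) {t : ℝ} (ht : t ∈ Icc (0 : ℝ) c.γ) :
    ‖deriv (S.Ec X φ) t‖ ≤ S.E₀ / S.r * Real.exp (-c.κ * (T.sys (k + 1)).dj X) := by
  have h := norm_deriv_le_of_supLetter_closedBall S.r_pos (S.holo X φ hφ) (S.bound X φ hφ) (S.ball_subset t ht)
  have e : S.E₀ * Real.exp (-c.κ * (T.sys (k + 1)).dj X) / S.r = S.E₀ / S.r * Real.exp (-c.κ * (T.sys (k + 1)).dj X) := by ring
  rw [← e]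
  exact h

/-- **THE FOUR-PART BIRTH LETTER OF THE LOCALIZED TERM** — the input shape `hb_diff ∕ hb_im ∕ hb_deriv ∕ hb_real` of the analytic history tower
`B12Eq213AnalyticHistory.analyticHistory_letters`, for `E^{(k+1)}(X, ·, φ)` instead of the un-localised total action, on ONE open convex `Re`-closed
neighbourhood `O` of `[0, γ]` (the rectangle of half-width `r∕4`, the SAME for every `(X, φ)`): holomorphy on `O`, imaginary-part letter
`|Im Ec| ≤ E₀·e^{−κ d_{k+1}(X)}`, derivative letter `‖Ec′‖ ≤ (2E₀∕r)·e^{−κ d_{k+1}(X)}`, and real compatibility on `[0, γ]` (`γ ≥ 0`).  With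
`rect_isOpen ∕ rect_convex ∕ ofReal_re_mem_rect ∕ ofReal_mem_rect` this is everything a LOCALIZED analytic tower in an older coupling would consume at
its birth level; the localized propagation itself is the object W1, not here. [cite: Balaban1987RG1, p.266 (after (2.9)) with (1.18) p.263 and §0 (0.23) p.256] -/
theorem birthLetter_lastCoupling_of_eHolo (hγ : 0 ≤ c.γ) (S : EHoloAt T c k) (X : (T.sys (k + 1)).Dom) {φ : Φ}
    (hφ : φ ∈ T.space (k + 1) X c.α₀ c.α₁) :
    DifferentiableOn ℂ (S.Ec X φ) {z : ℂ | z.re ∈ Ioo (-(S.r / 4)) (c.γ + S.r / 4) ∧ z.im ∈ Ioo (-(S.r / 4)) (S.r / 4)} ∧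
    (∀ z ∈ {z : ℂ | z.re ∈ Ioo (-(S.r / 4)) (c.γ + S.r / 4) ∧ z.im ∈ Ioo (-(S.r / 4)) (S.r / 4)},
      |(S.Ec X φ z).im| ≤ S.E₀ * Real.exp (-c.κ * (T.sys (k + 1)).dj X)) ∧
    (∀ z ∈ {z : ℂ | z.re ∈ Ioo (-(S.r / 4)) (c.γ + S.r / 4) ∧ z.im ∈ Ioo (-(S.r / 4)) (S.r / 4)},
      ‖deriv (S.Ec X φ) z‖ ≤ 2 * S.E₀ / S.r * Real.exp (-c.κ * (T.sys (k + 1)).dj X)) ∧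
    (∀ t ∈ Icc (0 : ℝ) c.γ, S.Ec X φ t = T.E (k + 1) X t φ) := by
  obtain ⟨hD, hderiv, -, hDU⟩ := derivLetter_of_supLetter_closedBalls (S := Icc (0 : ℝ) c.γ) S.r_pos (S.holo X φ hφ)
    (S.bound X φ hφ) S.ball_subset
  -- the rectangle lies inside the union of the `r∕2`-discs (`2·(r∕4) = r∕2`)
  have hsub : {z : ℂ | z.re ∈ Ioo (-(S.r / 4)) (c.γ + S.r / 4) ∧ z.im ∈ Ioo (-(S.r / 4)) (S.r / 4)} ⊆
      ⋃ t ∈ Icc (0 : ℝ) c.γ, ball (t : ℂ) (S.r / 2) := by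
    have h := rect_subset_iUnion_ball (γ := c.γ) (ρ := S.r / 4) hγ
    have e : 2 * (S.r / 4) = S.r / 2 := by ring
    rwa [e] at h
  have e : 2 * (S.E₀ * Real.exp (-c.κ * (T.sys (k + 1)).dj X)) / S.r
      = 2 * S.E₀ / S.r * Real.exp (-c.κ * (T.sys (k + 1)).dj X) := by ring
  refine ⟨hD.mono hsub, fun z hz => ?_, fun z hz => ?_, fun t ht => (S.eq X φ hφ t ht).symm⟩
  · exact (Complex.abs_im_le_norm _).trans (S.bound X φ hφ z (hDU (hsub hz)))
  · rw [← e]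
    exact hderiv z (hsub hz)

/-- **EVERY `C^{n,1}` LETTER IN THE LAST COUPLING, WITH DECAY** (p. 263 «It is a C^∞-function of g_{j−1} ∈ [0, γ]» made quantitative in the
«(or analytic)» alternative): from `S : EHoloAt T c k` (`γ > 0`), for `φ ∈ Uᶜ_{k+1}(X, α₀, α₁)` and `g, g′ ∈ [0, γ]`, the `n`-th `g`-derivative
(within `[0, γ]`) of `E^{(k+1)}(X, ·, φ)` is Lipschitz: `‖∂ⁿE(g) − ∂ⁿE(g′)‖ ≤ (n+1)!·E₀·r^{−(n+1)}·e^{−κ d_{k+1}(X)}·|g − g′|`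
(`EHoloAt.eDerivBoundAt` at order `n + 1` + the mean value inequality on the convex interval). [cite: Balaban1987RG1, p.263 (clause before (1.18)) with p.266 (after (2.9))] -/
theorem norm_iteratedDerivWithin_sub_le_of_eHolo (hγ : 0 < c.γ) (S : EHoloAt T c k) (n : ℕ) (X : (T.sys (k + 1)).Dom)
    {φ : Φ} (hφ : φ ∈ T.space (k + 1) X c.α₀ c.α₁) {g g' : ℝ} (hg : g ∈ Icc (0 : ℝ) c.γ) (hg' : g' ∈ Icc (0 : ℝ) c.γ) :
    ‖iteratedDerivWithin n (fun x => T.E (k + 1) X x φ) (Icc 0 c.γ) g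
        - iteratedDerivWithin n (fun x => T.E (k + 1) X x φ) (Icc 0 c.γ) g'‖ ≤
      (n + 1).factorial * S.E₀ / S.r ^ (n + 1) * Real.exp (-c.κ * (T.sys (k + 1)).dj X) * |g - g'| := by
  set f : ℝ → ℂ := fun x => T.E (k + 1) X x φ with hf
  have hs : UniqueDiffOn ℝ (Icc (0 : ℝ) c.γ) := uniqueDiffOn_Icc hγ
  have hcd : ContDiffOn ℝ ((n + 1 : ℕ) : WithTop ℕ∞) f (Icc 0 c.γ) := S.eSmoothAt X φ hφ (n + 1)
  have h1 : ContDiffOn ℝ 1 (iteratedDerivWithin n f (Icc 0 c.γ)) (Icc 0 c.γ) :=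
    ((contDiffOn_nat_succ_iff_contDiffOn_one_iteratedDerivWithin hs).1 hcd).2
  have hd : DifferentiableOn ℝ (iteratedDerivWithin n f (Icc 0 c.γ)) (Icc 0 c.γ) := h1.differentiableOn one_ne_zero
  have hbound : ∀ x ∈ Icc (0 : ℝ) c.γ, ‖derivWithin (iteratedDerivWithin n f (Icc 0 c.γ)) (Icc 0 c.γ) x‖ ≤
      (n + 1).factorial * S.E₀ / S.r ^ (n + 1) * Real.exp (-c.κ * (T.sys (k + 1)).dj X) := by
    intro x hx
    have e : derivWithin (iteratedDerivWithin n f (Icc 0 c.γ)) (Icc 0 c.γ) = iteratedDerivWithin (n + 1) f (Icc 0 c.γ) :=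
      iteratedDerivWithin_succ.symm
    rw [e]
    exact S.eDerivBoundAt hγ (n + 1) X φ hφ hx
  have h := (convex_Icc (0 : ℝ) c.γ).norm_image_sub_le_of_norm_derivWithin_le hd hbound hg' hg
  rwa [Real.norm_eq_abs] at h

/-- **THE LIPSCHITZ LETTER IN THE LAST COUPLING, WITH DECAY — «analyticity in the last coupling ⇒ Lipschitz via a Cauchy estimate on the typed
disc».**  From `S : EHoloAt T c k` (`γ > 0`), for `φ ∈ Uᶜ_{k+1}(X, α₀, α₁)` and `g, g′ ∈ [0, γ]`:
**`‖E^{(k+1)}(X, g, φ) − E^{(k+1)}(X, g′, φ)‖ ≤ (E₀∕r)·e^{−κ d_{k+1}(X)}·|g − g′|`** — node N22's age-0 modulus `Λ (k+1) k = E₀∕r` for the localized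
term, explicit in the two numbers of the typed disc (the `n = 0` instance of `norm_iteratedDerivWithin_sub_le_of_eHolo`). [cite: Balaban1987RG1, p.263 (clause before (1.18)) with p.266 (after (2.9)) and (1.18)] -/
theorem norm_sub_lastCoupling_le_of_eHolo (hγ : 0 < c.γ) (S : EHoloAt T c k) (X : (T.sys (k + 1)).Dom) {φ : Φ}
    (hφ : φ ∈ T.space (k + 1) X c.α₀ c.α₁) {g g' : ℝ} (hg : g ∈ Icc (0 : ℝ) c.γ) (hg' : g' ∈ Icc (0 : ℝ) c.γ) :
    ‖T.E (k + 1) X g φ - T.E (k + 1) X g' φ‖ ≤ S.E₀ / S.r * Real.exp (-c.κ * (T.sys (k + 1)).dj X) * |g - g'| := by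
  have h := norm_iteratedDerivWithin_sub_le_of_eHolo hγ S 0 X hφ hg hg'
  simpa only [iteratedDerivWithin_zero, zero_add, Nat.factorial_one, Nat.cast_one, one_mul, pow_one] using h

/-- **ROAD 2's LETTER (R) AT AGE 0, WITH DECAY**: the `g`-derivative (within `[0, γ]`) of `E^{(k+1)}(X, ·, φ)` is Lipschitz with constant
`(2E₀∕r²)·e^{−κ d_{k+1}(X)}` — the `C^{1,1}` clause of `BalabanUVNodesN22Knit.ne9_and_fadingMemory_of_osc_growingSmooth` for the last coupling, per
section (the `n = 1` instance). [cite: Balaban1987RG1, p.263 (clause before (1.18)) with p.266 (after (2.9))] -/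
theorem norm_derivWithin_sub_le_of_eHolo (hγ : 0 < c.γ) (S : EHoloAt T c k) (X : (T.sys (k + 1)).Dom) {φ : Φ}
    (hφ : φ ∈ T.space (k + 1) X c.α₀ c.α₁) {g g' : ℝ} (hg : g ∈ Icc (0 : ℝ) c.γ) (hg' : g' ∈ Icc (0 : ℝ) c.γ) :
    ‖derivWithin (fun x => T.E (k + 1) X x φ) (Icc 0 c.γ) g - derivWithin (fun x => T.E (k + 1) X x φ) (Icc 0 c.γ) g'‖ ≤
      2 * S.E₀ / S.r ^ 2 * Real.exp (-c.κ * (T.sys (k + 1)).dj X) * |g - g'| := by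
  have h := norm_iteratedDerivWithin_sub_le_of_eHolo hγ S 1 X hφ hg hg'
  have e : ((1 + 1).factorial : ℝ) * S.E₀ / S.r ^ (1 + 1) = 2 * S.E₀ / S.r ^ 2 := by norm_num [Nat.factorial]
  rw [iteratedDerivWithin_one, e] at h
  exact h

/-- The typed disc's (1.18)-constant is non-negative as soon as the analyticity domain of `X` is inhabited. [folklore] -/
theorem eHolo_E₀_nonneg (S : EHoloAt T c k) (X : (T.sys (k + 1)).Dom) {φ : Φ} (hφ : φ ∈ T.space (k + 1) X c.α₀ c.α₁)
    (hγ : 0 ≤ c.γ) : 0 ≤ S.E₀ := by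
  have h0 : (0 : ℝ) ∈ Icc (0 : ℝ) c.γ := ⟨le_rfl, hγ⟩
  have hU : ((0 : ℝ) : ℂ) ∈ S.U := S.ball_subset 0 h0 (mem_closedBall_self S.r_pos.le)
  have h := (norm_nonneg _).trans (S.bound X φ hφ _ hU)
  exact nonneg_of_mul_nonneg_left h (Real.exp_pos _)

/-! ## §3 Along node N09's family of typed discs: the k-uniform last-coupling modulus -/

/-- **ONE k-UNIFORM LAST-COUPLING MODULUS FROM N09's PER-STEP HOLOMORPHIC SOURCES.**  Along a family `S k : EHoloAt T c k` (`k < K` — the hypothesis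
`hE` of `B12NodeKnit.b12_main_of_up_frameOf_of_b13Family_eHolo`) whose typed discs have (1.18)-constants `≤ E₀` and margins `≥ r > 0`: for every `k < K`,
`φ ∈ Uᶜ_{k+1}(X, α₀, α₁)`, `g, g′ ∈ [0, γ]`: `‖E^{(k+1)}(X, g, φ) − E^{(k+1)}(X, g′, φ)‖ ≤ (E₀∕r)·e^{−κ d_{k+1}(X)}·|g − g′|` — the Lipschitz letter is
k-uniform exactly when the two numbers of the typed disc are. [cite: Balaban1987RG1, p.263 (clause before (1.18): «positive, absolute γ») with Thm 3 p.264] -/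
theorem norm_sub_lastCoupling_le_uniform_of_eHolo (hγ : 0 < c.γ) {K : ℕ} (S : ∀ k, k < K → EHoloAt T c k) {E₀ r : ℝ}
    (hr : 0 < r) (hE₀ : ∀ k (hk : k < K), (S k hk).E₀ ≤ E₀) (hrS : ∀ k (hk : k < K), r ≤ (S k hk).r)
    {k : ℕ} (hk : k < K) (X : (T.sys (k + 1)).Dom) {φ : Φ} (hφ : φ ∈ T.space (k + 1) X c.α₀ c.α₁)
    {g g' : ℝ} (hg : g ∈ Icc (0 : ℝ) c.γ) (hg' : g' ∈ Icc (0 : ℝ) c.γ) :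
    ‖T.E (k + 1) X g φ - T.E (k + 1) X g' φ‖ ≤ E₀ / r * Real.exp (-c.κ * (T.sys (k + 1)).dj X) * |g - g'| := by
  have h := norm_sub_lastCoupling_le_of_eHolo hγ (S k hk) X hφ hg hg'
  have h0 : 0 ≤ (S k hk).E₀ := eHolo_E₀_nonneg (S k hk) X hφ hγ.le
  have hq : (S k hk).E₀ / (S k hk).r ≤ E₀ / r := div_le_div₀ (h0.trans (hE₀ k hk)) (hE₀ k hk) hr (hrS k hk)
  exact h.trans (mul_le_mul_of_nonneg_right (mul_le_mul_of_nonneg_right hq (Real.exp_pos _).le) (abs_nonneg _))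

end Tower

/-! ## §4 Reading a last-coupling letter against node N22's statement `NE9 ∧ FadingMemory` (abstract carriers) -/

section Reading

open Literature.MathematicalPhysics.QuantumFieldTheory.Balaban1983to89.T4OutputRate
open Literature.MathematicalPhysics.QuantumFieldTheory.Balaban1983to89.T4CouplingLogLayer (lastOnly fadingMemory_lastOnly_const)
open scoped BigOperators

variable {C : Carriers} {Bg : Type} {E : Functional C Bg}

/-- The history sum of `NE9` against the table `lastOnly (fun _ _ ↦ L)` charges the last coupling only:
`Σ_{i < k} (lastOnly L) k i · |g i − g′ i| = L·|g (k−1) − g′ (k−1)|` for `k ≥ 1` (and `0` for `k = 0`). [folklore] -/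
theorem sum_lastOnly_const (L : ℝ) (g g' : ℕ → ℝ) {k : ℕ} (hk : 0 < k) :
    ∑ i ∈ Finset.range k, lastOnly (fun _ _ => L) k i * |g i - g' i| = L * |g (k - 1) - g' (k - 1)| := by
  rw [Finset.sum_eq_single (k - 1)]
  · simp only [lastOnly, if_true]
  · intro i _ hi
    simp only [lastOnly, if_neg hi, zero_mul]
  · intro h
    exact absurd (Finset.mem_range.2 (by omega)) h

/-- **A LAST-COUPLING LETTER IS `NE9` WITH A ONE-ENTRY TABLE.**  If on the window `W` the `g`-differences of the functional are controlled by the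
LAST coupling alone — `|E g U X − E g′ U X| ≤ L·e^{−κd(X)}·|g_{j−1} − g′_{j−1}|`, `j = scale X ≥ 1`, and no dependence at scale `0` — then
`NE9 E W κ (lastOnly (fun _ _ ↦ L))` (`T4CouplingLogLayer.lastOnly`).  This is the shape §2 delivers per localized term in the MARKOV typing of
`Step.SFTower.E` (one real coupling); it is NOT node N22's history content. [folklore] -/
theorem ne9_of_lastCouplingLetter {W : Set (ℕ → ℝ)} {κ L : ℝ}
    (hL : ∀ g ∈ W, ∀ g' ∈ W, ∀ (U : Bg) (X : C.Dom), 0 < C.scale X →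
      |E g U X - E g' U X| ≤ L * Real.exp (-(κ * C.d X)) * |g (C.scale X - 1) - g' (C.scale X - 1)|)
    (h0 : ∀ g ∈ W, ∀ g' ∈ W, ∀ (U : Bg) (X : C.Dom), C.scale X = 0 → E g U X = E g' U X) :
    NE9 E W κ (lastOnly fun _ _ => L) := by
  intro g hg g' hg' U X
  rcases Nat.eq_zero_or_pos (C.scale X) with hX | hX
  · rw [hX, Finset.range_zero, Finset.sum_empty, mul_zero, h0 g hg g' hg' U X hX, sub_self, abs_zero]
  · rw [sum_lastOnly_const L g g' hX]
    calc |E g U X - E g' U X| ≤ L * Real.exp (-(κ * C.d X)) * |g (C.scale X - 1) - g' (C.scale X - 1)| :=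
          hL g hg g' hg' U X hX
      _ = Real.exp (-(κ * C.d X)) * (L * |g (C.scale X - 1) - g' (C.scale X - 1)|) := by ring

/-- **NODE N22's JOINT SHAPE FROM A LAST-COUPLING LETTER** (memory length one): under the hypotheses of `ne9_of_lastCouplingLetter` with `0 ≤ L`, for
every rate `ω ∈ ]0, 1]`: `NE9 E W κ Λ ∧ FadingMemory (L∕ω) ω Λ`, `Λ = lastOnly (fun _ _ ↦ L)` (`T4CouplingLogLayer.fadingMemory_lastOnly_const` BY
NAME).  HONEST: the memory clause is idle here — in a Markov typing the node's statement IS the last-coupling Lipschitz letter; the fading of a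
genuine history (older couplings through the curly bracket of (2.12)) is the object W1, not this theorem. [folklore] -/
theorem ne9_and_fadingMemory_of_lastCouplingLetter {W : Set (ℕ → ℝ)} {κ L ω : ℝ}
    (hL : ∀ g ∈ W, ∀ g' ∈ W, ∀ (U : Bg) (X : C.Dom), 0 < C.scale X →
      |E g U X - E g' U X| ≤ L * Real.exp (-(κ * C.d X)) * |g (C.scale X - 1) - g' (C.scale X - 1)|)
    (h0 : ∀ g ∈ W, ∀ g' ∈ W, ∀ (U : Bg) (X : C.Dom), C.scale X = 0 → E g U X = E g' U X)
    (hL0 : 0 ≤ L) (hω : 0 < ω) (hω1 : ω ≤ 1) :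
    NE9 E W κ (lastOnly fun _ _ => L) ∧ FadingMemory (L / ω) ω (lastOnly fun _ _ => L) :=
  ⟨ne9_of_lastCouplingLetter hL h0, fadingMemory_lastOnly_const hL0 hω hω1⟩

end Reading

end Summit.QuantumFields.YangMills.BalabanUVNodes.N22LastCouplingHolo

end
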